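import Summits.FinalStateConjecture.FinalStateConjecture.Theorems.StarvedNecksNeckGapDecayGlueTopology
import Summits.FinalStateConjecture.FinalStateConjecture.Theorems.StarvedNecksNeckGapDecayGlueLate
import Summits.FinalStateConjecture.FinalStateConjecture.Theorems.StarvedNecksNeckGapDecayGlueDeviation
import Literature.Geometry.Lorentzian.FinalState
import Literature.Geometry.Lorentzian.BackgroundChartCalculus
import Literature.Uncategorized.NearIdInjOpen
import Literature.Uncategorized.MovingShellCutoff
import HarnessLib

/-!
# Gluing toolbox for the gap certificate, V: the belt chart — (G1), (G2) and the local formulas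
# (crux `StarvedNecks.NeckGapDecay`, stmt-FinalStateConjecture-16768, line `Sketch`, packaging stub P-glue `stub_certOfCoreFrom`)

BELT CONSTRUCTION of the glued chart of hole `i` from the input near-zone chart `Ψᵢ` and the core chart `Ψ'`:
with the moving-shell cut-off `χ` of stub W3 (`= 0` for `s ≤ ϱ(t)+3/2` and `s ≥ ϱ(t)+7/2`, `= 1` on `[ϱ+2, ϱ+3]`,
`C³`-bounded by `G` uniformly in time; rest time `t`, Euclidean rest norm `s`, seam radius `ϱ(t)`), put
`P := χ·(T − id)`, `S := id + P`, and `Ψg := Ψᵢ ∘ ι⁻¹ ∘ S` on `{s < ϱ(t) + 5/2}`, `Ψg := Ψ'` beyond.  On the middle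
shell `χ = 1`, `S = T`, and `Ψᵢ ∘ T = Ψ'` by the matching clause (C2), so `Ψg = Ψᵢ ∘ ι⁻¹ ∘ S` on `{s < ϱ + 3}`
and `Ψg = Ψ'` on `{s > ϱ + 2}` (late).  Since `T − id → 0` in `C³` on the collar slabs, from a late time `τa` on
`‖P‖ ≤ η`, `‖DʲP‖ ≤ 8Gη ≤ 1/2` with `η ≤ 1/(8(‖Λ⁻¹‖+1))` (`late_field_bounds`): stub W1 makes `S` co-Lipschitz and
open on the late half-space, `S` maps late domain points into the domain and moves rest time / rest norm by `≤ 1/8`.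
(G2): inside `R₁ + 1 ≤ ϱ − Mᵢ`, `s ≤ r + |a| ≤ ϱ`, so `χ = 0`, `S = id`, `Ψg = Ψᵢ`.  (G1): smooth by the two local
formulas; injective on the late tube by the late-chart open embedding of `Ψᵢ` + W1 (both points below the switching
sphere), by (C1) (both beyond) and by the separation (C4) (mixed, via the `1/8` shifts and `|ϱ′| ≤ 1`); open by W1 and
the two open embeddings; image in `d.charted`.  References: DHRT arXiv:2104.08222, §1 (late charts);
O'Neill 1983, Ch. 3.  No new definitions.
-/

noncomputable section
open scoped Manifold ContDiff Topology ENNReal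
open Filter Set Function Topology Literature.Geometry.Lorentzian

namespace Summit.FinalStateConjecture.FinalStateConjecture.Theorems.NeckGapDecay.ConnectionLevelCones.Glue

set_option linter.dupNamespace false
-- instance search through nested operator types `E4 →L[ℝ] E4 →L[ℝ] ℝ`
set_option maxSynthPendingDepth 3

set_option maxHeartbeats 1600000 in
/-- **The belt chart** of the gap certificate (Parts (G1), (G2) of P-glue `stub_certOfCoreFrom`).  Given the data of a
gap core certificate of hole `i` except its decay clauses — seam radius `ϱ` (smooth, slow, `≥ R₁ + Mᵢ + 1`), the chart `Ψ'`
of the annular late tube (C1) matched to the input chart `Ψᵢ` to third order across the seam collar (C2) and separated from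
`Ψᵢ`'s inner image (C4) — and the bricks W1, W3, there are a cut-off `χ` (W3's), constants `G, τa, τs` and a GLUED chart
`Ψg` of hole `i`'s background with: the cut-off facts; `S := id + χ·(T − id)` maps late domain points into the domain and
moves rest time / rest norm by `≤ 1/8`; (G1) smooth open embedding of the late sub-wall tube `{τs < t, r < W(x⁰)+1}` into
`d.charted`; (G2) `Ψg = Ψᵢ` inside `R₁ + 1`; and the two local formulas `Ψg = Ψᵢ ∘ ι⁻¹ ∘ S` on `{s < ϱ(t) + 3}`,
`Ψg = Ψ'` on `{s > ϱ(t) + 2}` (late).  DHRT arXiv:2104.08222, §1; O'Neill 1983, Ch. 3. [folklore] -/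
theorem exists_beltChart (hW1 : Literature.Uncategorized.NearIdInjOpen) (hW3 : Literature.Uncategorized.MovingShellCutoff)
    (𝓢 : Spacetime.{0} 4) (O : Set 𝓢.carrier) (d : FinalStateDecomposition 𝓢 O 4) (R₀ : ℝ) (i : Fin d.N) (W : ℝ → ℝ)
    (hMR : 100 * d.mass i ≤ R₀) (hWc : Continuous W) (R₁ τ₁ : ℝ) (ϱ : ℝ → ℝ)
    (Ψ' : (d.background i).domain → 𝓢.carrier) (T : E4 → E4) (hR₁ : R₀ ≤ R₁) (hτ₀1 : d.τ₀ ≤ τ₁)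
    (hϱs : ContDiff ℝ ∞ ϱ) (hϱ1 : ∀ u, |deriv ϱ u| ≤ 1) (hϱ2 : ∀ u, |iteratedDeriv 2 ϱ u| ≤ 1)
    (hϱ3 : ∀ u, |iteratedDeriv 3 ϱ u| ≤ 1) (hϱR : ∀ u, R₁ + d.mass i + 1 ≤ ϱ u)
    (hC1s : ContMDiffOn 𝓘(ℝ, E4) (𝓡 4) ∞ Ψ' {x : (d.background i).domain | τ₁ < (d.background i).time x.1 ∧
        ϱ ((d.background i).time x.1) + 1 < E4.spatialNorm (poincareInv (d.motion i).1 (d.motion i).2 x.1) ∧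
        (d.background i).radius x.1 < W (x.1 0) + 1})
    (hC1e : Topology.IsOpenEmbedding (Set.restrict {x : (d.background i).domain | τ₁ < (d.background i).time x.1 ∧
        ϱ ((d.background i).time x.1) + 1 < E4.spatialNorm (poincareInv (d.motion i).1 (d.motion i).2 x.1) ∧
        (d.background i).radius x.1 < W (x.1 0) + 1} Ψ'))
    (hC1i : Ψ' '' {x : (d.background i).domain | τ₁ < (d.background i).time x.1 ∧
        ϱ ((d.background i).time x.1) + 1 < E4.spatialNorm (poincareInv (d.motion i).1 (d.motion i).2 x.1) ∧
        (d.background i).radius x.1 < W (x.1 0) + 1} ⊆ d.charted)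
    (hTs : ContDiff ℝ ∞ T)
    (hC2 : ∀ x : (d.background i).domain, τ₁ < (d.background i).time x.1 →
      ϱ ((d.background i).time x.1) + 1 < E4.spatialNorm (poincareInv (d.motion i).1 (d.motion i).2 x.1) →
      E4.spatialNorm (poincareInv (d.motion i).1 (d.motion i).2 x.1) < ϱ ((d.background i).time x.1) + 4 →
      ∃ hx : T x.1 ∈ (d.background i).domain, Ψ' x = d.chart i ⟨T x.1, hx⟩)
    (hC2t : Tendsto (fun τ ↦ supCkENorm (Subtype.val '' {x : (d.background i).domain | (d.background i).time x.1 = τ ∧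
      ϱ τ + 1 ≤ E4.spatialNorm (poincareInv (d.motion i).1 (d.motion i).2 x.1) ∧
      E4.spatialNorm (poincareInv (d.motion i).1 (d.motion i).2 x.1) ≤ ϱ τ + 4}) 3 (fun y ↦ T y - y)) atTop (𝓝 0))
    (hC4 : ∀ x y : (d.background i).domain, τ₁ < (d.background i).time x.1 →
      ϱ ((d.background i).time x.1) + 3 ≤ E4.spatialNorm (poincareInv (d.motion i).1 (d.motion i).2 x.1) →
      (d.background i).radius x.1 < W (x.1 0) + 1 → τ₁ - 1 < (d.background i).time y.1 →
      E4.spatialNorm (poincareInv (d.motion i).1 (d.motion i).2 y.1) ≤ ϱ ((d.background i).time y.1) + 11 / 4 →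
      Ψ' x ≠ d.chart i y) :
    ∃ (χ : E4 → ℝ) (G τa τs : ℝ) (Ψg : (d.background i).domain → 𝓢.carrier),
      let B := d.background i; let t := B.time; let r := B.radius;
      let s : E4 → ℝ := fun y ↦ E4.spatialNorm (poincareInv (d.motion i).1 (d.motion i).2 y);
      let S : E4 → E4 := fun y ↦ y + χ y • (T y - y);
      ContDiff ℝ ∞ χ ∧ (∀ x, 0 ≤ χ x ∧ χ x ≤ 1) ∧ (∀ x, s x ≤ ϱ (t x) + 3 / 2 → χ x = 0) ∧
      (∀ x, ϱ (t x) + 7 / 2 ≤ s x → χ x = 0) ∧ 0 ≤ G ∧ (∀ j, j ≤ 3 → ∀ x, ‖iteratedFDeriv ℝ j χ x‖ ≤ G) ∧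
      τ₁ + 2 ≤ τs ∧ τa + 2 ≤ τs ∧
      (∀ x : E4, x ∈ (B.domain : Set E4) → τa ≤ t x → S x ∈ (B.domain : Set E4)) ∧
      (∀ x : E4, τa ≤ t x → |t (S x) - t x| ≤ 1 / 8 ∧ |s (S x) - s x| ≤ 1 / 8) ∧
      (let U : Set B.domain := {x | τs < t x.1 ∧ r x.1 < W (x.1 0) + 1};
        ContMDiffOn 𝓘(ℝ, E4) (𝓡 4) ∞ Ψg U ∧ Topology.IsOpenEmbedding (U.restrict Ψg) ∧ Ψg '' U ⊆ d.charted) ∧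
      (∀ x : B.domain, r x.1 ≤ R₁ + 1 → Ψg x = d.chart i x) ∧
      (∀ x : B.domain, τs - 1 < t x.1 → s x.1 < ϱ (t x.1) + 3 → Ψg x = (d.chart i ∘ (chartAt E4 x).symm) (S x.1)) ∧
      (∀ x : B.domain, τs - 1 < t x.1 → ϱ (t x.1) + 2 < s x.1 → Ψg x = Ψ' x) := by
  classical
  set Λ : lorentzGroup := (d.motion i).1 with hΛ
  set c : E4 := (d.motion i).2 with hc
  set M : ℝ := d.mass i with hM
  set a : ℝ := d.spin i with ha
  have hBdef : d.background i = boostedKerrBackground Λ c M a := rfl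
  have htime : ∀ y : E4, (d.background i).time y = poincareInv Λ c y 0 := fun _ ↦ rfl
  have hrad : ∀ y : E4, (d.background i).radius y = Kerr.radius a (poincareInv Λ c y) := fun _ ↦ rfl
  have hM0 : 0 < M := d.mass_pos i
  have haM : |a| ≤ M := d.abs_spin_le_mass i
  have hR₁M : M ≤ R₁ := by linarith
  have hR₁0 : 0 ≤ R₁ := by linarith
  have hϱ1' : ∀ u, 1 ≤ ϱ u := fun u ↦ by linarith [hϱR u]
  obtain ⟨χ, G, hχs, hχ01, hχ0in, hχ0out, hχ1, hχG⟩ := hW3 Λ c ϱ hϱs hϱ1' hϱ1 hϱ2 hϱ3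
  set sN : E4 → ℝ := fun y ↦ E4.spatialNorm (poincareInv Λ c y) with hsN
  have hG0 : 0 ≤ G := (norm_nonneg _).trans (hχG 0 (by norm_num) 0)
  have hc_t : Continuous fun y : E4 ↦ (d.background i).time y := continuous_time Λ c
  have hc_s : Continuous sN := continuous_spatialNorm Λ c
  have hc_r : Continuous fun y : E4 ↦ (d.background i).radius y :=
    (Kerr.continuous_radius a).comp (continuous_poincareInv Λ c)
  have hc_ϱt : Continuous fun y : E4 ↦ ϱ ((d.background i).time y) := hϱs.continuous.comp hc_t
  have hϱlip : ∀ u v, |ϱ u - ϱ v| ≤ |u - v| := abs_sub_le_of_deriv hϱs hϱ1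
  set L : ℝ := ‖(((Λ : E4 ≃L[ℝ] E4).symm : E4 ≃L[ℝ] E4) : E4 →L[ℝ] E4)‖ with hL
  have hL0 : 0 ≤ L := norm_nonneg _
  set η : ℝ := min (1 / (16 * (G + 1))) (1 / (8 * (L + 1))) with hη
  have hη0 : 0 < η := lt_min (by positivity) (by positivity)
  have hηG : 16 * (G + 1) * η ≤ 1 := by
    have h1 : η ≤ 1 / (16 * (G + 1)) := min_le_left _ _
    rw [le_div_iff₀ (by positivity)] at h1; linarith
  have hηL : 8 * (L + 1) * η ≤ 1 := by
    have h1 : η ≤ 1 / (8 * (L + 1)) := min_le_right _ _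
    rw [le_div_iff₀ (by positivity)] at h1; linarith
  have hLη : L * η ≤ 1 / 8 := by nlinarith
  have hη8 : η ≤ 1 / 8 := by nlinarith
  have h8Gη : 8 * G * η ≤ 1 / 2 := by nlinarith
  -- `C³`-smallness of `T − id` on the late collar slabs, at any level `e > 0`
  have hTbε : ∀ e : ℝ, 0 < e → ∃ τe : ℝ, ∀ x : E4, τe ≤ poincareInv Λ c x 0 →
      ϱ (poincareInv Λ c x 0) + 1 ≤ E4.spatialNorm (poincareInv Λ c x) →
      E4.spatialNorm (poincareInv Λ c x) ≤ ϱ (poincareInv Λ c x 0) + 4 →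
      ∀ j, j ≤ 3 → ‖iteratedFDeriv ℝ j (fun y ↦ T y - y) x‖ ≤ e := by
    intro e he
    obtain ⟨τe, hτe⟩ := exists_forall_norm_iteratedFDeriv_le_of_tendsto hC2t he
    refine ⟨τe, fun x hxt hx1 hx4 j hj ↦ ?_⟩
    have hxdom : x ∈ ((d.background i).domain : Set E4) := by
      rw [hBdef]
      refine mem_domain_of_lt_spatialNorm Λ c hM0.le a ?_
      have := hϱR (poincareInv Λ c x 0)
      linarith [abs_nonneg a]
    exact hτe (poincareInv Λ c x 0) hxt x ⟨⟨x, hxdom⟩, ⟨rfl, hx1, hx4⟩, rfl⟩ j hj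
  -- late bounds of the interpolation field `P = χ·(T − id)` at any level `e > 0`
  have hPbε : ∀ e : ℝ, 0 < e → ∃ τe : ℝ, ∀ x : E4, τe ≤ (d.background i).time x →
      ‖χ x • (T x - x)‖ ≤ e ∧ ∀ j, 1 ≤ j → j ≤ 3 → ‖iteratedFDeriv ℝ j (fun y ↦ χ y • (T y - y)) x‖ ≤ 8 * G * e := by
    intro e he
    obtain ⟨τe, hτe⟩ := hTbε e he
    exact ⟨τe, fun x hx ↦ late_field_bounds Λ c hϱs.continuous hχs hχ01 hχ0in hχ0out hG0 hχG hTs he.le hτe hx⟩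
  obtain ⟨τa, hPb⟩ := hPbε η hη0
  have hPs : ContDiff ℝ ∞ (fun y ↦ χ y • (T y - y)) := hχs.smul (hTs.sub contDiff_id)
  have hSs : ContDiff ℝ ∞ (fun y ↦ y + χ y • (T y - y)) := contDiff_id.add hPs
  have hshift : ∀ x : E4, τa ≤ (d.background i).time x →
      ‖(x + χ x • (T x - x)) - x‖ ≤ η ∧
      |(d.background i).time (x + χ x • (T x - x)) - (d.background i).time x| ≤ 1 / 8 ∧
      |sN (x + χ x • (T x - x)) - sN x| ≤ 1 / 8 := by
    intro x hx
    have h1 : ‖(x + χ x • (T x - x)) - x‖ ≤ η := by rw [add_sub_cancel_left]; exact (hPb x hx).1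
    refine ⟨h1, ?_, ?_⟩
    · exact (abs_time_sub_le Λ c x _).trans ((mul_le_mul_of_nonneg_left h1 hL0).trans hLη)
    · exact (abs_spatialNorm_sub_le Λ c x _).trans ((mul_le_mul_of_nonneg_left h1 hL0).trans hLη)
  have hshell : ∀ x : E4, χ x ≠ 0 → ϱ ((d.background i).time x) + 3 / 2 < sN x := by
    intro x hx
    by_contra h
    exact hx (hχ0in x (not_lt.mp h))
  have hSdom : ∀ x : E4, x ∈ ((d.background i).domain : Set E4) → τa ≤ (d.background i).time x →
      x + χ x • (T x - x) ∈ ((d.background i).domain : Set E4) := by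
    intro x hxd hxt
    by_cases hχx : χ x = 0
    · simpa [hχx] using hxd
    · have h1 := hshell x hχx
      obtain ⟨-, -, h3⟩ := hshift x hxt
      rw [hBdef]
      refine mem_domain_of_lt_spatialNorm Λ c hM0.le a ?_
      have h4 := hϱR ((d.background i).time x)
      have h5 : sN x - 1 / 8 ≤ sN (x + χ x • (T x - x)) := by linarith [(abs_le.mp h3).1]
      show 2 * M + |a| < sN (x + χ x • (T x - x))
      linarith
  set τs : ℝ := max τ₁ τa + 2 with hτs
  have hτs1 : τ₁ + 2 ≤ τs := by simp only [hτs]; linarith [le_max_left τ₁ τa]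
  have hτsa : τa + 2 ≤ τs := by simp only [hτs]; linarith [le_max_right τ₁ τa]
  have hKo : IsOpen {x : E4 | τs - 1 < poincareInv Λ c x 0} := isOpen_setOf_lt_time Λ c _
  have hKc : Convex ℝ {x : E4 | τs - 1 < poincareInv Λ c x 0} := convex_setOf_lt_time Λ c _
  obtain ⟨hcoLip, hSopen⟩ := hW1 (fun y ↦ χ y • (T y - y)) {x : E4 | τs - 1 < poincareInv Λ c x 0} hKo hKc
    (fun x _ ↦ (hPs.differentiable (by simp)).differentiableAt)
    (fun x hx ↦ by
      rw [norm_fderiv_eq_norm_iteratedFDeriv_one]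
      have h := (hPb x (by show τa ≤ poincareInv Λ c x 0; exact le_of_lt (by linarith [hx.out]))).2 1 le_rfl
        (by norm_num)
      linarith)
  set Ψg : (d.background i).domain → 𝓢.carrier := fun x ↦
    if sN x.1 < ϱ ((d.background i).time x.1) + 5 / 2 then
      (d.chart i ∘ (chartAt E4 x).symm) (x.1 + χ x.1 • (T x.1 - x.1))
    else Ψ' x with hΨg
  have hψ : ∀ (x : (d.background i).domain) (z : E4) (hz : z ∈ ((d.background i).domain : Set E4)),
      (d.chart i ∘ (chartAt E4 x).symm) z = d.chart i ⟨z, hz⟩ := by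
    intro x z hz
    show d.chart i ((chartAt E4 x).symm z) = _
    congr 1
    exact Subtype.ext (OpensChart.chartAt_symm_val x hz)
  have hF1 : ∀ x : (d.background i).domain, sN x.1 < ϱ ((d.background i).time x.1) + 5 / 2 →
      Ψg x = (d.chart i ∘ (chartAt E4 x).symm) (x.1 + χ x.1 • (T x.1 - x.1)) := fun x hx ↦ by
    simp only [hΨg, if_pos hx]
  have hF2 : ∀ x : (d.background i).domain, ¬ sN x.1 < ϱ ((d.background i).time x.1) + 5 / 2 → Ψg x = Ψ' x :=
    fun x hx ↦ by simp only [hΨg, if_neg hx]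
  -- (E1) on the middle shell the two formulas agree
  have hE1 : ∀ x : (d.background i).domain, τs - 1 < (d.background i).time x.1 →
      ϱ ((d.background i).time x.1) + 2 ≤ sN x.1 → sN x.1 ≤ ϱ ((d.background i).time x.1) + 3 →
      Ψ' x = (d.chart i ∘ (chartAt E4 x).symm) (x.1 + χ x.1 • (T x.1 - x.1)) := by
    intro x hxt hx2 hx3
    have hχx : χ x.1 = 1 := hχ1 x.1 hx2 hx3
    have hS : x.1 + χ x.1 • (T x.1 - x.1) = T x.1 := by rw [hχx, one_smul, add_sub_cancel]
    obtain ⟨hTx, hΨ'x⟩ := hC2 x (by linarith) (by linarith) (by linarith)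
    rw [hΨ'x, hS, hψ x (T x.1) hTx]
  have hE2 : ∀ x : (d.background i).domain, τs - 1 < (d.background i).time x.1 →
      ϱ ((d.background i).time x.1) + 2 < sN x.1 → Ψg x = Ψ' x := by
    intro x hxt hx2
    by_cases h : sN x.1 < ϱ ((d.background i).time x.1) + 5 / 2
    · rw [hF1 x h, ← hE1 x hxt hx2.le (by linarith)]
    · exact hF2 x h
  -- (E3) inside `ϱ + 3` (late) the glued chart is `Ψᵢ ∘ ι⁻¹ ∘ S`
  have hE3 : ∀ x : (d.background i).domain, τs - 1 < (d.background i).time x.1 →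
      sN x.1 < ϱ ((d.background i).time x.1) + 3 →
      Ψg x = (d.chart i ∘ (chartAt E4 x).symm) (x.1 + χ x.1 • (T x.1 - x.1)) := by
    intro x hxt hx3
    by_cases h : sN x.1 < ϱ ((d.background i).time x.1) + 5 / 2
    · exact hF1 x h
    · rw [hF2 x h]
      exact hE1 x hxt (by linarith [not_lt.mp h]) hx3.le
  have hG2 : ∀ x : (d.background i).domain, (d.background i).radius x.1 ≤ R₁ + 1 → Ψg x = d.chart i x := by
    intro x hxr
    have hs1 : sN x.1 ≤ (d.background i).radius x.1 + |a| := spatialNorm_poincareInv_le_radius_add_abs Λ c a x.1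
    have hs2 : sN x.1 ≤ ϱ ((d.background i).time x.1) := by
      have := hϱR ((d.background i).time x.1); linarith
    have hs3 : sN x.1 ≤ ϱ ((d.background i).time x.1) + 3 / 2 := by linarith
    have hχx : χ x.1 = 0 := hχ0in x.1 hs3
    have hs4 : sN x.1 < ϱ ((d.background i).time x.1) + 5 / 2 := by linarith
    rw [hF1 x hs4, hχx, zero_smul, add_zero]
    exact hψ x x.1 x.2
  set U : Set (d.background i).domain :=
    {x | τs < (d.background i).time x.1 ∧ (d.background i).radius x.1 < W (x.1 0) + 1} with hU
  set V₁p : Set (d.background i).domain :=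
    {x | τs - 1 < (d.background i).time x.1 ∧ sN x.1 < ϱ ((d.background i).time x.1) + 3} with hV₁p
  set V₂p : Set (d.background i).domain :=
    {x | τs - 1 < (d.background i).time x.1 ∧ ϱ ((d.background i).time x.1) + 2 < sN x.1} with hV₂p
  set Aset : Set (d.background i).domain :=
    {x | τ₁ < (d.background i).time x.1 ∧ ϱ ((d.background i).time x.1) + 1 < sN x.1 ∧
      (d.background i).radius x.1 < W (x.1 0) + 1} with hAset
  have hc_tv : Continuous fun x : (d.background i).domain ↦ (d.background i).time x.1 :=
    hc_t.comp continuous_subtype_val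
  have hc_sv : Continuous fun x : (d.background i).domain ↦ sN x.1 := hc_s.comp continuous_subtype_val
  have hc_rv : Continuous fun x : (d.background i).domain ↦ (d.background i).radius x.1 :=
    hc_r.comp continuous_subtype_val
  have hc_ϱtv : Continuous fun x : (d.background i).domain ↦ ϱ ((d.background i).time x.1) :=
    hc_ϱt.comp continuous_subtype_val
  have hc_Wv : Continuous fun x : (d.background i).domain ↦ W (x.1 0) + 1 :=
    (hWc.comp ((PiLp.continuous_apply 2 _ 0).comp continuous_subtype_val)).add continuous_const
  have hUo : IsOpen U := (isOpen_lt continuous_const hc_tv).inter (isOpen_lt hc_rv hc_Wv)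
  have hV₁o : IsOpen V₁p := (isOpen_lt continuous_const hc_tv).inter (isOpen_lt hc_sv (hc_ϱtv.add continuous_const))
  have hV₂o : IsOpen V₂p := (isOpen_lt continuous_const hc_tv).inter (isOpen_lt (hc_ϱtv.add continuous_const) hc_sv)
  have hAo : IsOpen Aset := (isOpen_lt continuous_const hc_tv).inter
    ((isOpen_lt (hc_ϱtv.add continuous_const) hc_sv).inter (isOpen_lt hc_rv hc_Wv))
  have hC1s' : ContMDiffOn 𝓘(ℝ, E4) (𝓡 4) ∞ Ψ' Aset := hC1s
  have hC1e' : IsOpenEmbedding (Aset.restrict Ψ') := hC1e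
  have hC1i' : Ψ' '' Aset ⊆ d.charted := hC1i
  have hUV : U ⊆ V₁p ∪ V₂p := by
    intro x hx
    rcases lt_or_ge (sN x.1) (ϱ ((d.background i).time x.1) + 3) with h | h
    · exact Or.inl ⟨by linarith [hx.1], h⟩
    · exact Or.inr ⟨by linarith [hx.1], by linarith⟩
  have hV₂A : ∀ x ∈ V₂p, x ∈ U → x ∈ Aset := fun x hx hxU ↦
    ⟨by linarith [hx.1], by linarith [hx.2], hxU.2⟩
  have hlateU : ∀ x ∈ U, τa ≤ (d.background i).time x.1 := fun x hx ↦ by linarith [hx.1]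
  have hlateV : ∀ x : (d.background i).domain, τs - 1 < (d.background i).time x.1 → τa ≤ (d.background i).time x.1 :=
    fun x hx ↦ by linarith
  have hSlate : ∀ x : (d.background i).domain, τs - 1 < (d.background i).time x.1 →
      x.1 + χ x.1 • (T x.1 - x.1) ∈ ((d.background i).domain : Set E4) ∧
      d.τ₀ < (d.background i).time (x.1 + χ x.1 • (T x.1 - x.1)) := by
    intro x hxt
    refine ⟨hSdom x.1 x.2 (hlateV x hxt), ?_⟩
    obtain ⟨-, h2, -⟩ := hshift x.1 (hlateV x hxt)
    linarith [(abs_le.mp h2).1]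
  have hΨi : ContMDiff 𝓘(ℝ, E4) (𝓡 4) ∞ (d.chart i) := (d.isLateChart i).contMDiff
  have hψs : ∀ x₀ : (d.background i).domain,
      ContMDiffOn 𝓘(ℝ, E4) (𝓡 4) ∞ (d.chart i ∘ (chartAt E4 x₀).symm) ((d.background i).domain : Set E4) :=
    fun x₀ ↦ 𝓢.contMDiffOn_comp_chartAt_symm (d.background i) (d.chart i) x₀ hΨi
  have hSval : ContMDiff 𝓘(ℝ, E4) 𝓘(ℝ, E4) ∞ (fun x : (d.background i).domain ↦ x.1 + χ x.1 • (T x.1 - x.1)) :=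
    hSs.contMDiff.comp contMDiff_subtype_val
  have hbranch1 : ∀ x₀ : (d.background i).domain, ContMDiffOn 𝓘(ℝ, E4) (𝓡 4) ∞
      (fun x : (d.background i).domain ↦ (d.chart i ∘ (chartAt E4 x₀).symm) (x.1 + χ x.1 • (T x.1 - x.1))) V₁p :=
    fun x₀ ↦ (hψs x₀).comp hSval.contMDiffOn fun x hx ↦ (hSlate x hx.1).1
  have hG1a : ContMDiffOn 𝓘(ℝ, E4) (𝓡 4) ∞ Ψg U := by
    intro x hx
    rcases hUV hx with hx1 | hx2
    · have h1 : ContMDiffAt 𝓘(ℝ, E4) (𝓡 4) ∞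
          (fun y : (d.background i).domain ↦ (d.chart i ∘ (chartAt E4 x).symm) (y.1 + χ y.1 • (T y.1 - y.1))) x :=
        (hbranch1 x x hx1).contMDiffAt (hV₁o.mem_nhds hx1)
      have hev : Ψg =ᶠ[𝓝 x]
          fun y : (d.background i).domain ↦ (d.chart i ∘ (chartAt E4 x).symm) (y.1 + χ y.1 • (T y.1 - y.1)) := by
        filter_upwards [hV₁o.mem_nhds hx1] with y hy
        exact hE3 y hy.1 hy.2
      exact (h1.congr_of_eventuallyEq hev).contMDiffWithinAt
    · have h1 : ContMDiffAt 𝓘(ℝ, E4) (𝓡 4) ∞ Ψ' x := (hC1s' x (hV₂A x hx2 hx)).contMDiffAt (hAo.mem_nhds (hV₂A x hx2 hx))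
      have hev : Ψg =ᶠ[𝓝 x] Ψ' := by
        filter_upwards [hV₂o.mem_nhds hx2] with y hy
        exact hE2 y hy.1 hy.2
      exact (h1.congr_of_eventuallyEq hev).contMDiffWithinAt
  have hinjᵢ : InjOn (d.chart i) ((d.background i).lateRegion d.τ₀) :=
    injOn_of_isOpenEmbedding_restrict (d.isLateChart i).isOpenEmbedding
  have hinj' : InjOn Ψ' Aset := injOn_of_isOpenEmbedding_restrict hC1e'
  have hKmem : ∀ x ∈ U, x.1 ∈ {x : E4 | τs - 1 < poincareInv Λ c x 0} := fun x hx ↦ by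
    show τs - 1 < (d.background i).time x.1; linarith [hx.1]
  have hkey : ∀ x ∈ U, ∀ y ∈ U, Ψg x = Ψg y → sN x.1 < ϱ ((d.background i).time x.1) + 5 / 2 → x = y := by
    intro x hx y hy hxy hxs
    have hxt : τs - 1 < (d.background i).time x.1 := by linarith [hx.1]
    have hyt : τs - 1 < (d.background i).time y.1 := by linarith [hy.1]
    obtain ⟨hSx, hSxt⟩ := hSlate x hxt
    have hgx : Ψg x = d.chart i ⟨_, hSx⟩ := by rw [hE3 x hxt (by linarith), hψ x _ hSx]
    by_cases hy3 : sN y.1 < ϱ ((d.background i).time y.1) + 3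
    · -- both points read through `Ψᵢ ∘ S`
      obtain ⟨hSy, hSyt⟩ := hSlate y hyt
      have hgy : Ψg y = d.chart i ⟨_, hSy⟩ := by rw [hE3 y hyt hy3, hψ y _ hSy]
      have h1 : (⟨_, hSx⟩ : (d.background i).domain) = ⟨_, hSy⟩ :=
        hinjᵢ (show d.τ₀ < _ from hSxt) (show d.τ₀ < _ from hSyt) (hgx.symm.trans (hxy.trans hgy))
      have h2 : x.1 + χ x.1 • (T x.1 - x.1) = y.1 + χ y.1 • (T y.1 - y.1) := congrArg Subtype.val h1
      have h3 := hcoLip x.1 (hKmem x hx) y.1 (hKmem y hy)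
      rw [h2, sub_self, norm_zero, mul_zero] at h3
      exact Subtype.ext (norm_sub_eq_zero_iff.mp (le_antisymm h3 (norm_nonneg _)))
    · -- `y` is in the far annulus: separation (C4)
      push Not at hy3
      have hgy : Ψg y = Ψ' y := hE2 y hyt (by linarith)
      obtain ⟨-, h2, h3⟩ := hshift x.1 (hlateV x hxt)
      have ht' : τ₁ - 1 < (d.background i).time (x.1 + χ x.1 • (T x.1 - x.1)) := by
        linarith [(abs_le.mp h2).1]
      have hϱ' := hϱlip ((d.background i).time (x.1 + χ x.1 • (T x.1 - x.1))) ((d.background i).time x.1)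
      have hs' : sN (x.1 + χ x.1 • (T x.1 - x.1)) ≤ ϱ ((d.background i).time (x.1 + χ x.1 • (T x.1 - x.1))) + 11 / 4 := by
        linarith [(abs_le.mp h3).2, (abs_le.mp hϱ').1, (abs_le.mp h2).1, (abs_le.mp h2).2]
      have hne := hC4 y ⟨_, hSx⟩ (by linarith [hy.1]) hy3 hy.2 ht' hs'
      exact (hne (hgy.symm.trans (hxy.symm.trans hgx))).elim
  have hinj : InjOn Ψg U := by
    intro x hx y hy hxy
    by_cases hxs : sN x.1 < ϱ ((d.background i).time x.1) + 5 / 2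
    · exact hkey x hx y hy hxy hxs
    by_cases hys : sN y.1 < ϱ ((d.background i).time y.1) + 5 / 2
    · exact (hkey y hy x hx hxy.symm hys).symm
    · push Not at hxs hys
      have hxA : x ∈ Aset := ⟨by linarith [hx.1], by linarith, hx.2⟩
      have hyA : y ∈ Aset := ⟨by linarith [hy.1], by linarith, hy.2⟩
      rw [hF2 x (not_lt.mpr hxs), hF2 y (not_lt.mpr hys)] at hxy
      exact hinj' hxA hyA hxy
  have hopen : ∀ V : Set (d.background i).domain, IsOpen V → V ⊆ U → IsOpen (Ψg '' V) := by
    intro V hV hVU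
    have heq₁ : EqOn Ψg (fun y : (d.background i).domain ↦
        (d.chart i ∘ (chartAt E4 y).symm) (y.1 + χ y.1 • (T y.1 - y.1))) V₁p := fun y hy ↦ hE3 y hy.1 hy.2
    have heq₂ : EqOn Ψg Ψ' V₂p := fun y hy ↦ hE2 y hy.1 hy.2
    rw [image_eq_union_of_eqOn (hVU.trans hUV) heq₁ heq₂]
    refine IsOpen.union ?_ ?_
    · -- the inner piece: `Ψᵢ` of the `S`-image
      set O₁ : Set E4 := Subtype.val '' (V ∩ V₁p) with hO₁
      have hO₁o : IsOpen O₁ := (d.background i).domain.2.isOpenMap_subtype_val _ (hV.inter hV₁o)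
      have hO₁K : O₁ ⊆ {x : E4 | τs - 1 < poincareInv Λ c x 0} := by
        rintro _ ⟨y, hy, rfl⟩; exact hy.2.1
      have hSO : IsOpen ((fun x : E4 ↦ x + χ x • (T x - x)) '' O₁) := hSopen O₁ hO₁o hO₁K
      set N : Set (d.background i).domain := Subtype.val ⁻¹' ((fun x : E4 ↦ x + χ x • (T x - x)) '' O₁) with hN
      have hNo : IsOpen N := hSO.preimage continuous_subtype_val
      have hNlate : N ⊆ (d.background i).lateRegion d.τ₀ := by
        rintro z ⟨_, ⟨y, hy, rfl⟩, hz⟩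
        show d.τ₀ < (d.background i).time z.1
        rw [← hz]
        exact (hSlate y hy.2.1).2
      have himg : (fun y : (d.background i).domain ↦ (d.chart i ∘ (chartAt E4 y).symm)
          (y.1 + χ y.1 • (T y.1 - y.1))) '' (V ∩ V₁p) = d.chart i '' N := by
        ext p
        constructor
        · rintro ⟨y, hy, rfl⟩
          have hSy := (hSlate y hy.2.1).1
          refine ⟨⟨_, hSy⟩, ⟨y.1, ⟨y, hy, rfl⟩, rfl⟩, ?_⟩
          exact (hψ y _ hSy).symm
        · rintro ⟨z, ⟨_, ⟨y, hy, rfl⟩, hz⟩, rfl⟩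
          have hSy := (hSlate y hy.2.1).1
          refine ⟨y, hy, ?_⟩
          have hz' : z = ⟨_, hSy⟩ := Subtype.ext hz.symm
          rw [hz']
          exact hψ y _ hSy
      rw [himg]
      exact isOpen_image_of_isOpenEmbedding_restrict (d.isLateChart i).isOpenEmbedding hNo hNlate
    · -- the outer piece: `Ψ'` of an open subset of `A`
      exact isOpen_image_of_isOpenEmbedding_restrict hC1e' (hV.inter hV₂o) fun y hy ↦ hV₂A y hy.2 (hVU hy.1)
  have himgU : Ψg '' U ⊆ d.charted := by
    rintro _ ⟨x, hx, rfl⟩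
    rcases hUV hx with hx1 | hx2
    · obtain ⟨hSx, hSxt⟩ := hSlate x hx1.1
      rw [hE3 x hx1.1 hx1.2, hψ x _ hSx]
      exact d.region_subset_charted i ⟨⟨_, hSx⟩, hSxt, rfl⟩
    · rw [hE2 x hx2.1 hx2.2]
      exact hC1i' ⟨x, hV₂A x hx2 hx, rfl⟩
  have hG1 : ContMDiffOn 𝓘(ℝ, E4) (𝓡 4) ∞ Ψg U ∧ IsOpenEmbedding (U.restrict Ψg) ∧ Ψg '' U ⊆ d.charted :=
    ⟨hG1a, isOpenEmbedding_restrict_of_forall_isOpen_image hUo hG1a.continuousOn hinj hopen, himgU⟩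
  refine ⟨χ, G, τa, τs, Ψg, hχs, hχ01, hχ0in, hχ0out, hG0, hχG, hτs1, hτsa, hSdom,
    fun x hx ↦ ⟨(hshift x hx).2.1, (hshift x hx).2.2⟩, hG1, hG2, hE3, hE2⟩

end Summit.FinalStateConjecture.FinalStateConjecture.Theorems.NeckGapDecay.ConnectionLevelCones.Glue

end
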